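import Mathlib
import Summits.Ventures.HodgeRepro2.T5AdicCompletionMap

/-!
# THE DEGREE OF A COMPLETION: `[L_w : K_v] ≤ [L : K]`, and `= 2` for a quadratic `L/K` with `L_w ≠ K_v`
(T5CompletionDegree)

For number fields `K ⊆ L`, a finite place `w` of `L` above `v` of `K`, and the canonical algebra
`K_v → L_w` of T5AdicCompletionMap (row 79): Mathlib's `Module.Finite K_v L_w` instance (the
`K_v`-linear map `K_v ⊗[K] L → L_w` has closed, dense range) refined to the RANK BOUND
`finrank K_v L_w ≤ finrank K L`; the two-sided statement `finrank K_v L_w = 2` for a quadratic `L/K`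
as soon as one element of `L_w` is not in the image of `K_v`. This is the hypothesis `h2` of the
ramified chain (rows 169–177) and of Theorem N5.T2's per-place statements, produced from the
GLOBAL degree and one local non-membership — the first step of a concrete instance.

No axiom beyond the standard trio; nothing of the scored record changes.
§8(d): uses an L-value-free non-vanishing device: NO.
-/

namespace Summit.Ventures.HodgeRepro2.T5CompletionDegree

open IsDedekindDomain HeightOneSpectrum NumberField
open scoped TensorProduct

variable {K : Type*} [Field K] [NumberField K] (v : HeightOneSpectrum (NumberField.RingOfIntegers K))
  {L : Type*} [Field L] [NumberField L] [Algebra K L] (w : HeightOneSpectrum (NumberField.RingOfIntegers L))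
  [w.asIdeal.LiesOver v.asIdeal]
  [ContinuousSMul (v.adicCompletion K) (w.adicCompletion L)]
  [IsScalarTower K (v.adicCompletion K) (w.adicCompletion L)]

/-- The `K_v`-linear map `K_v ⊗[K] L → L_w`, `a ⊗ l ↦ a · l`. -/
noncomputable def tensorToCompletion :
    ((v.adicCompletion K) ⊗[K] L) →ₗ[v.adicCompletion K] (w.adicCompletion L) :=
  (Algebra.TensorProduct.lift (Algebra.algHom (v.adicCompletion K) (v.adicCompletion K) (w.adicCompletion L))
    (Algebra.algHom K L (w.adicCompletion L)) (fun _ _ ↦ mul_comm _ _)).toLinearMap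

omit [ContinuousSMul (v.adicCompletion K) (w.adicCompletion L)] in
/-- `K_v ⊗[K] L → L_w` has dense range (it contains the image of `L`). -/
theorem denseRange_tensorToCompletion : DenseRange (tensorToCompletion v w) := by
  apply (w.denseRange_algebraMap L).mono
  rintro _ ⟨l, rfl⟩
  exact ⟨1 ⊗ₜ l, by simp [tensorToCompletion, Algebra.algHom]⟩

open scoped Valued in
/-- `K_v ⊗[K] L → L_w` is surjective: its range is a finite-dimensional, hence closed, dense subspace. -/
theorem surjective_tensorToCompletion : Function.Surjective (tensorToCompletion v w) := by
  have hcl := (tensorToCompletion v w).range.closed_of_finiteDimensional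
  have hd : Dense (Set.range (tensorToCompletion v w)) := denseRange_tensorToCompletion v w
  rw [← Set.range_eq_univ, ← hd.closure_eq]
  exact hcl.closure_eq.symm

/-- THE RANK BOUND: `[L_w : K_v] ≤ [L : K]`. -/
theorem finrank_le :
    Module.finrank (v.adicCompletion K) (w.adicCompletion L) ≤ Module.finrank K L := by
  have hsurj := surjective_tensorToCompletion v w
  calc Module.finrank (v.adicCompletion K) (w.adicCompletion L)
      = Module.finrank (v.adicCompletion K) (LinearMap.range (tensorToCompletion v w)) := by
        rw [LinearMap.range_eq_top.mpr hsurj, finrank_top]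
    _ ≤ Module.finrank (v.adicCompletion K) ((v.adicCompletion K) ⊗[K] L) :=
        LinearMap.finrank_range_le _
    _ = Module.finrank K L := by
        rw [Module.finrank_tensorProduct, Module.finrank_self, one_mul]

/-- `[L_w : K_v] ≥ 2` as soon as some element of `L_w` is not in the image of `K_v`. -/
theorem two_le_finrank_of_notMem_range {x : w.adicCompletion L}
    (hx : x ∉ Set.range (algebraMap (v.adicCompletion K) (w.adicCompletion L))) :
    2 ≤ Module.finrank (v.adicCompletion K) (w.adicCompletion L) := by
  have hpos : 0 < Module.finrank (v.adicCompletion K) (w.adicCompletion L) := Module.finrank_pos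
  have hne : Module.finrank (v.adicCompletion K) (w.adicCompletion L) ≠ 1 := by
    intro h1
    have htop : (⊤ : IntermediateField (v.adicCompletion K) (w.adicCompletion L)) = ⊥ := by
      rw [← IntermediateField.finrank_eq_one_iff, IntermediateField.finrank_top', h1]
    have hx' : x ∈ (⊤ : IntermediateField (v.adicCompletion K) (w.adicCompletion L)) :=
      IntermediateField.mem_top
    rw [htop, IntermediateField.mem_bot] at hx'
    exact hx hx'
  omega

/-- `[L_w : K_v] = 2` for a quadratic `L/K` with `L_w ≠ K_v`: the hypothesis `h2` of the ramified chain
from the GLOBAL degree and one local non-membership. -/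
theorem finrank_eq_two (hKL : Module.finrank K L = 2) {x : w.adicCompletion L}
    (hx : x ∉ Set.range (algebraMap (v.adicCompletion K) (w.adicCompletion L))) :
    Module.finrank (v.adicCompletion K) (w.adicCompletion L) = 2 :=
  le_antisymm ((finrank_le v w).trans hKL.le) (two_le_finrank_of_notMem_range v w hx)

omit [ContinuousSMul (v.adicCompletion K) (w.adicCompletion L)]
  [IsScalarTower K (v.adicCompletion K) (w.adicCompletion L)] in
/-- An element of `L_w` whose square is `−1` is not in the image of `K_v` if `−1` is not a square in `K_v`. -/
theorem notMem_range_of_sq_eq_neg_one (hK : ¬ ∃ y : v.adicCompletion K, y ^ 2 = -1)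
    {x : w.adicCompletion L} (hx : x ^ 2 = -1) :
    x ∉ Set.range (algebraMap (v.adicCompletion K) (w.adicCompletion L)) := by
  rintro ⟨y, rfl⟩
  apply hK
  refine ⟨y, (algebraMap (v.adicCompletion K) (w.adicCompletion L)).injective ?_⟩
  rw [map_pow, hx, map_neg, map_one]

end Summit.Ventures.HodgeRepro2.T5CompletionDegree
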